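import Summits.ResolutionOfSingularities.ResolutionOfSingularities.Theorems.FrobeniusLadderFInjectiveMacaulayficationE8ChartXPoints
import Summits.ResolutionOfSingularities.ResolutionOfSingularities.Theorems.FrobeniusLadderFInjectiveMacaulayficationHypersurfaceRegular
import Mathlib.Algebra.MvPolynomial.PDeriv
import HarnessLib

/-!
# The `x`-chart of `Bl_𝔪 E₈⁰` (characteristic `3`) is regular at every prime on the exceptional divisor

Support file for crux stmt-ResolutionOfSingularities-15315 (`FrobeniusLadder.FInjectiveMacaulayfication`,
line `Sketch`): stub `stub_e8ChartXPrimesChar3`, the second step of the characteristic-`3` tower on the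
non-affine scheme `X₁ = Bl_𝔪 E₈⁰` (the point blow-up of `E₈⁰ : z² + x³ + y⁵ = 0`).

The `x`-chart of the blow-up is the hypersurface ring `S/(gₓ)`, `S = k[X₀, X₁, X₂]`,
`gₓ = X₂² + X₀ + X₀³X₁⁵` (upstairs `X₀ = x` is the equation of the exceptional divisor `E`, `X₁ = y/x`,
`X₂ = z/x`). The engine interface needs regularity of `X₁` at EVERY point of the exceptional divisor in
this chart — closed or not — i.e. at the local ring `(S/(gₓ))_Q` of every PRIME ideal `Q ∋ X̄₀` of
`S/(gₓ)` (the characteristic-`5` template `E8ChartXPoints.stub_e8ChartXPoints` only treated maximal `Q`).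
The argument is characteristic-free: `∂gₓ/∂X₀ = 1 + X₀ · (3 X₀ X₁⁵)` (`E8ChartXPoints.pderiv_zero_gx`), so
`∂gₓ/∂X₀ ∉ P` for the proper ideal `P := Q ∩ S ∋ X₀` (`E8ChartXPoints.pderiv_zero_gx_not_mem`), and the
Jacobian criterion in the `X₀`-direction (`HypersurfaceRegular.stub_hypersurfaceRegularOfPderiv`,
Matsumura Thm. 30.4 (ii), valid at any prime) makes `(S/(gₓ))_Q` a regular local ring.

References: H. Matsumura, *Commutative Ring Theory*, Cambridge Stud. Adv. Math. 8, CUP 1986,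
Thm. 30.4 (ii) [Matsumura1987]; the computation of the chart and its derivative is folklore.
-/

-- single-problem summit: the doubled namespace component is forced
set_option linter.dupNamespace false

noncomputable section

namespace Summit.ResolutionOfSingularities.ResolutionOfSingularities.Theorems.FInjectiveMacaulayfication.E8ChartXPrimesChar3

open MvPolynomial

/-- **The `x`-chart of `Bl_𝔪 E₈⁰` is regular at every prime of the exceptional divisor** (registered stub
`stub_e8ChartXPrimesChar3`, characteristic `3`): for a field `k` of characteristic `3`,
`gₓ = X₂² + X₀ + X₀³X₁⁵` and every prime ideal `Q ∋ X̄₀` of `k[X₀, X₁, X₂]/(gₓ)`, the local ring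
`(k[X]/(gₓ))_Q` is a regular local ring. Proof: `P := Q ∩ k[X]` is a proper (prime) ideal containing
`X₀`, so `∂gₓ/∂X₀ = 1 + X₀ · (3 X₀ X₁⁵) ∉ P` (`E8ChartXPoints.pderiv_zero_gx_not_mem`), and the Jacobian
criterion in the `X₀`-direction (`HypersurfaceRegular.stub_hypersurfaceRegularOfPderiv`,
Matsumura Thm. 30.4 (ii)) makes `(k[X]/(gₓ))_Q` regular local. The characteristic hypothesis is not used.
[cite: Matsumura1987, Thm. 30.4 (ii)] -/
theorem stub_e8ChartXPrimesChar3 : ∀ (k : Type) [Field k] [CharP k 3] (gx : MvPolynomial (Fin 3) k),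
    gx = MvPolynomial.X 2 ^ 2 + MvPolynomial.X 0 + MvPolynomial.X 0 ^ 3 * MvPolynomial.X 1 ^ 5 →
    ∀ (Q : Ideal (MvPolynomial (Fin 3) k ⧸ Ideal.span {gx})) [Q.IsPrime],
      Ideal.Quotient.mk (Ideal.span {gx}) (MvPolynomial.X 0) ∈ Q →
      IsRegularLocalRing (Localization.AtPrime Q) := by
  intro k _ _ gx hgx Q hQ hX0
  subst hgx
  -- the prime `P = Q ∩ k[X]` above `Q` is proper and contains `X₀`, so `∂gₓ/∂X₀ ∉ P`
  have hder := E8ChartXPoints.pderiv_zero_gx_not_mem k _ (Ideal.comap_ne_top _ hQ.ne_top)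
    (Ideal.mem_comap.mpr hX0)
  -- Jacobian criterion in the `X₀`-direction: the local ring is regular
  exact HypersurfaceRegular.stub_hypersurfaceRegularOfPderiv k 3 _ 0 Q hder

end Summit.ResolutionOfSingularities.ResolutionOfSingularities.Theorems.FInjectiveMacaulayfication.E8ChartXPrimesChar3

end
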